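import Summits.QuantumFields.BalabanUV.T4Continuum.Spine.NE2BalabanWaveWitness
import Summits.QuantumFields.BalabanUV.T4Continuum.Support.LatticeCosineProfileDiff
import Summits.QuantumFields.BalabanUV.T4Continuum.Spine.NE2BalabanWexpDiff

/-!
# T⁴ programme, spine node NE2 (U1a), tier B rows B5 × B6 × B7 — THE LONGITUDINAL WAVE: an `x`-dependent witness for ROOT B's END whose
# LATTICE-DERIVATIVE TOWER `D_νw_ν` is NOT identically zero, with ITS two-level consistency across the block hierarchy

NE2 formalisation swarm, leaf prover 03 (row B5 lineage; support row «B7.w END WITNESSES», fourth file; INTENT CLAIMS.log l.9575).  The three landed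
witness families (`Spine/NE2BalabanFlatWitness` p212801, `…ConstWitness` p213007, `…WaveWitness` p213393) meet the SECOND member
`D_νw_ν = RegularBackgroundTower.dconnTower` of node NE3's class `regClass = {w, D_νw_ν}` with ZERO (flat ∕ constant ∕ transverse data).  Here the
wave of p213393 is taken LONGITUDINAL — `waveRg A θ μ μ : R^{(k)}_μ(x) = exp((θ·cos(2π·val(x_μ)/(n_k M_μ))/n_k · A)`, `R_ν = 1` (`ν ≠ μ`) — so that
`D_μw_μ^{(k)}(x) = n_k·(w_k(x) − w_k(x − e_μ))` is the discretised derivative of the profile ALONG the transporter's own direction (any `d ≥ 1`: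
unlike the transverse wave, no second direction is needed — leaf-08-g2's XREAD INFO-2, CLAIMS l.≈9610):
 * §1 the remainder-difference estimate for COMMUTING exponentials `‖(e^X − 1 − X) − (e^Y − 1 − Y)‖ ≤ 4‖Y‖‖X − Y‖ + ‖X − Y‖²` (Mathlib's
   `NormedSpace.exp_add_of_commute`, `Real.abs_exp_sub_one_le`, the tree's `norm_exp_sub_one_le_of_norm_le` ∕ `expRem_le_sq`) and its reading form
   `norm_wexpRem_sub_le`: `‖r_k(θc) − r_k(θc̃)‖ ≤ 6θ²|c − c̃|/n_k` (`|θ| ≤ ½`);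
 * §2 **`dconnTower_wave_long`**: `D_μw_μ^{(k)}(x, κ) = n_k·(w_k(θc_k(x)) − w_k(θc_k(x − e_μ)))` with `c_k(x − e_μ) = cos(ang − 2π/(n_kM_μ))`
   (`LatticeCosineProfileDiff.cang_sub_one`), `= 0` in the other directions; the decomposition `D = (θ·μ_k)·A + ρ_k`, `μ_k = n_k(c − c̃)` the
   main term, `‖ρ_k‖ ≤ 12πθ²/(n_k M_μ)` (`norm_dconn_sub_main_le`); and **`dconnTower_wave_long_ne_zero`**: at the site `e_μ` of a lattice with
   `n_k·M_μ ≥ 2` the derivative tower is ≠ 0 (`A ≠ 0`, `0 < |θ| ≤ ½`) — the second class member is GENUINELY exercised;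
 * §3 **`localRate_wave_long`**: node NE3's SHAPE `LocalRate (bgReadings (regClass (liftR (waveRg A θ μ μ)))) (betaW + betaD) L⁻¹` — BOTH class members
   two-level consistent across the block hierarchy: the connection member as in p213393, the derivative member by `LatticeCosineProfileDiff.abs_dmain_sub_le`
   (`n·sin(Ω/2n) = Ω/2 + O(n⁻²)`, `Ω = 2π/M_μ`) + `abs_ang_sub_ang_par_le` + §1 — this tests the `tauInv` convention and the `n_k`-scaling of
   `dconnTower` JOINTLY with the `par`-nesting of the B6 reading (owner's `localRate_of_consistent` BY NAME);
 * §4 **`balaban_final_rate_wave_long`** ∕ **`_at`** (θ = `thetaW`, p213393): ROOT B's END on the longitudinal wave with every other binder discharged.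

HONEST FRAMING (T4-DAG p. 1).  A TOY member of the data class (OURS); finite-dimensional algebra and elementary real analysis; asserts NOTHING
about Bałaban's minimisers `U_k(V)` (no B0, c5) and nothing about node NE3 away from this family; ROOT B for general data stays CONDITIONAL on node
NE3 (OPEN) and on row B5's class; NOT [B9] (3.23)–(3.26) as printed; NE2 (U1a) is NOT PROVED by this file (c1 with the carver); spine PROVED 0/9
unchanged; NOT infinite volume, NOT a mass gap, NOT Clay, NOT summit progress.  HONEST DEPENDENCY: continuum YM on T⁴ ⇐ BetaPertH ∧ nine spine
estimates (0/9 proved); BetaPertH ⇐ (D1) ∧ (D4) ∧ CAP+tail; G-an2-4 gates asym, D1 and NE2/3/4.  ABSOLUTE RULE kept; no `def … : Prop` fact; no `sorry`.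
-/

noncomputable section

open scoped BigOperators ComplexConjugate Matrix Matrix.Norms.L2Operator Kronecker
open Filter Topology NormedSpace Real

namespace Summit.QuantumFields.BalabanUV.T4Continuum.NE2BalabanLongWaveWitness

open Literature.MathematicalPhysics.QuantumFieldTheory.Balaban1983to89.B5Prop11Plancherel (Cst Cst_nonneg Tor fine unitVec)
open Literature.MathematicalPhysics.QuantumFieldTheory.Balaban1983to89.B5G183RateUnitTower (lev lev_neZero)
open Literature.MathematicalPhysics.QuantumFieldTheory.Balaban1983to89.B7Prop1Explicit (norm_exp_sub_one_le_of_norm_le expRem_le_sq)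
open Literature.MathematicalPhysics.QuantumFieldTheory.Balaban1983to89.T4EtaRateMin (LocalRate)
open Summit.QuantumFields.BalabanUV.T4Continuum
open Summit.QuantumFields.BalabanUV.T4Continuum.CovariantAveragingTower (TowerLimitRate)
open Summit.QuantumFields.BalabanUV.T4Continuum.BalabanAveragedTowerUnit (idx Qlev one_le_lev' lev_succ' cast_lev')
open Summit.QuantumFields.BalabanUV.T4Continuum.BalabanAveragedTowerModes (par val_par)
open Summit.QuantumFields.BalabanUV.T4Continuum.BackgroundResolventTower
open Summit.QuantumFields.BalabanUV.T4Continuum.BlockPairingGeometry (tau parT)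
open Summit.QuantumFields.BalabanUV.T4Continuum.AbelianCovariantLaplacian (tauInv)
open Summit.QuantumFields.BalabanUV.T4Continuum.KingPairingPlantedLaw
open Summit.QuantumFields.BalabanUV.T4Continuum.GramPerturbationLaw (C2gram)
open Summit.QuantumFields.BalabanUV.T4Continuum.NE2FromNE3 (bgReadings localRate_of_consistent)
open Summit.QuantumFields.BalabanUV.T4Continuum.RegularBackgroundTower (RegularTransporters connTower dconnTower regClass betaNE3 lev_pos)
open Summit.QuantumFields.BalabanUV.T4Continuum.GaugeTermScalarData (QuT Q1)
open Summit.QuantumFields.BalabanUV.T4Continuum.RegularSiteTransporters (siteT)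
open Summit.QuantumFields.BalabanUV.T4Continuum.NestedContourTransport (theta0)
open Summit.QuantumFields.BalabanUV.T4Continuum.NE2BalabanRoot (balabanPert)
open Summit.QuantumFields.BalabanUV.T4Continuum.NE2BalabanGauge (gaugeSlot liftR)
open Summit.QuantumFields.BalabanUV.T4Continuum.NE2BalabanLayerSharp (kappaBs C2Bs KstarR)
open Summit.QuantumFields.BalabanUV.T4Continuum.NE2BalabanWiring (epsR CdeltaR)
open Summit.QuantumFields.BalabanUV.T4Continuum.NE2BalabanFinal (kappa4F C4F)
open Summit.QuantumFields.BalabanUV.T4Continuum.NE2BalabanThreshold (etaStar etaStar_pos balaban_final_rate_of_regular)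
open Summit.QuantumFields.BalabanUV.T4Continuum.NE2BalabanConstWitness
open Summit.QuantumFields.BalabanUV.T4Continuum.NE2BalabanWaveWitness
open Summit.QuantumFields.BalabanUV.T4Continuum.LatticeCosineProfile
open Summit.QuantumFields.BalabanUV.T4Continuum.LatticeCosineProfileDiff
open Summit.QuantumFields.BalabanUV.T4Continuum.NE2BalabanWexpDiff

/-! ## §1 (moved) The remainder differences live in `Spine/NE2BalabanWexpDiff` (`norm_expRem_sub_expRem_le`, `norm_wexpRem_sub_le`) -/

/-! ## §2 The lattice-derivative tower of the longitudinal wave -/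

variable {d : ℕ} (L : ℕ) [NeZero L] (M : Fin d → ℕ) [hM : ∀ μ, NeZero (M μ)] (a : ℝ) (ha : 0 < a)
variable {o : Type*} [Fintype o] [DecidableEq o]
variable (A : Matrix o o ℂ) (θ : ℝ) (μ : Fin d)

omit [NeZero L] hM in
/-- a backward step in direction `μ` lowers the `μ`-coordinate by one. [folklore] -/
theorem tauInv_self (k : ℕ) (i : idx L M k) : (tauInv (fine (lev L k) M) μ i).1 μ = i.1 μ - 1 := by
  show (i.1 - unitVec (fine (lev L k) M) μ) μ = i.1 μ - 1
  rw [Pi.sub_apply, unitVec, Pi.single_eq_same]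

omit [NeZero L] hM in
/-- **THE LATTICE-DERIVATIVE TOWER OF THE LONGITUDINAL WAVE** in its own direction:
`D_μw_μ^{(k)}(x, κ) = n_k·(w_k(θ·c_k(x)) − w_k(θ·c_k(x − e_μ)))`. [folklore] -/
theorem dconnTower_wave_long (k : ℕ) (i : idx L M k) :
    dconnTower L M (liftR L M (waveRg L M A θ μ μ)) k μ i
      = ((lev L k : ℕ) : ℂ) • (wexp L (θ * cang (fine (lev L k) M μ) (i.1 μ)) A k
          - wexp L (θ * cang (fine (lev L k) M μ) (i.1 μ - 1)) A k) := by
  rw [dconnTower, connTower_wave_self, connTower_wave_self, tauInv_self]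

omit [NeZero L] hM in
/-- the other directions carry no derivative. [folklore] -/
theorem dconnTower_wave_long_ne {ν : Fin d} (hν : ν ≠ μ) (k : ℕ) (i : idx L M k) :
    dconnTower L M (liftR L M (waveRg L M A θ μ μ)) k ν i = 0 := by
  rw [dconnTower, connTower_wave_ne L M A θ μ μ hν, connTower_wave_ne L M A θ μ μ hν, sub_self, smul_zero]

/-- **MAIN TERM + REMAINDER**: `‖D_μw_μ^{(k)}(x, κ) − (θ·n_k(c_k(x) − c_k(x − e_μ)))·A‖ ≤ 12πθ²/(n_k M_μ)` (`|θ| ≤ ½`, `‖A‖ ≤ 1`; one backward step moves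
the profile by `≤ 2π/(n_k M_μ)`, and `norm_wexpRem_sub_le`). [folklore] -/
theorem norm_dconn_sub_main_le {A : Matrix o o ℂ} (hA : ‖A‖ ≤ 1) {θ : ℝ} (hθ : |θ| ≤ 1 / 2) (μ : Fin d) (k : ℕ) (i : idx L M k) :
    ‖dconnTower L M (liftR L M (waveRg L M A θ μ μ)) k μ i
        - ((θ * ((lev L k : ℕ) * (cang (fine (lev L k) M μ) (i.1 μ) - cang (fine (lev L k) M μ) (i.1 μ - 1))) : ℝ) : ℂ) • A‖
      ≤ 12 * π * θ ^ 2 / ((lev L k : ℕ) * (M μ : ℝ)) := by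
  have hn0 : (0 : ℝ) < ((lev L k : ℕ) : ℝ) := lev_pos L k
  have hMμ : (0 : ℝ) < M μ := by exact_mod_cast Nat.pos_of_ne_zero (NeZero.ne (M μ))
  set c := cang (fine (lev L k) M μ) (i.1 μ) with hc
  set c' := cang (fine (lev L k) M μ) (i.1 μ - 1) with hc'
  have hcc : |c - c'| ≤ 2 * π / ((lev L k : ℕ) * (M μ : ℝ)) := by
    have h := abs_cang_add_one_sub_le (fine (lev L k) M μ) (i.1 μ - 1)
    rw [sub_add_cancel] at h
    refine h.trans (le_of_eq ?_)
    simp only [fine]; push_cast; ring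
  -- `D − (θ n (c − c′))·A = n·(r(θc) − r(θc′))`
  have e : dconnTower L M (liftR L M (waveRg L M A θ μ μ)) k μ i
        - ((θ * ((lev L k : ℕ) * (c - c')) : ℝ) : ℂ) • A
      = ((lev L k : ℕ) : ℂ) • ((wexp L (θ * c) A k - ((θ * c : ℝ) : ℂ) • A) - (wexp L (θ * c') A k - ((θ * c' : ℝ) : ℂ) • A)) := by
    rw [dconnTower_wave_long, ← hc, ← hc']
    have e1 : ((θ * ((lev L k : ℕ) * (c - c')) : ℝ) : ℂ) • A
        = ((lev L k : ℕ) : ℂ) • ((((θ * c : ℝ) : ℂ)) • A - (((θ * c' : ℝ) : ℂ)) • A) := by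
      rw [← sub_smul, ← Complex.ofReal_sub, smul_smul, ← Complex.ofReal_natCast, ← Complex.ofReal_mul]
      congr 1; push_cast; ring
    rw [e1, ← smul_sub]
    congr 1; abel
  rw [e, norm_smul, Complex.norm_natCast]
  calc ((lev L k : ℕ) : ℝ) * ‖(wexp L (θ * c) A k - ((θ * c : ℝ) : ℂ) • A) - (wexp L (θ * c') A k - ((θ * c' : ℝ) : ℂ) • A)‖
      ≤ ((lev L k : ℕ) : ℝ) * (6 * θ ^ 2 * |c - c'| / ((lev L k : ℕ) : ℝ)) :=
        mul_le_mul_of_nonneg_left (norm_wexpRem_sub_le L hA hθ (abs_cang_le _ _) (abs_cang_le _ _) k) hn0.le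
    _ = 6 * θ ^ 2 * |c - c'| := by field_simp
    _ ≤ 6 * θ ^ 2 * (2 * π / ((lev L k : ℕ) * (M μ : ℝ))) := mul_le_mul_of_nonneg_left hcc (by positivity)
    _ = 12 * π * θ ^ 2 / ((lev L k : ℕ) * (M μ : ℝ)) := by ring

omit hM in
/-- **THE SECOND CLASS MEMBER IS GENUINELY EXERCISED**: on a lattice with `n_k·M_μ ≥ 2` the derivative tower of the longitudinal wave is NON-ZERO at
the site `e_μ` (any 1-form slot `κ`), for `A ≠ 0`, `‖A‖ ≤ 1`, `0 < |θ| < ½` — there `c(e_μ) = cos(2π/(n_kM_μ)) ≠ 1 = c(0)`, and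
`e^{sA} = e^{tA}` with `|s − t|·‖A‖ < 1` forces `s = t` (`NE2BalabanConstWitness.wexp_ne_zero`). [folklore] -/
theorem dconnTower_wave_long_ne_zero {A : Matrix o o ℂ} (hA0 : A ≠ 0) (hA : ‖A‖ ≤ 1) {θ : ℝ} (h0 : θ ≠ 0) (hθ : |θ| < 1 / 2)
    (μ : Fin d) (k : ℕ) (hm : 2 ≤ lev L k * M μ) (κ : Fin d) :
    dconnTower L M (liftR L M (waveRg L M A θ μ μ)) k μ (unitVec (fine (lev L k) M) μ, κ) ≠ 0 := by
  letI : NormedAlgebra ℚ (Matrix o o ℂ) := NormedAlgebra.restrictScalars ℚ ℂ (Matrix o o ℂ)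
  have hm' : 2 ≤ fine (lev L k) M μ := hm
  haveI : Fact (1 < fine (lev L k) M μ) := ⟨hm'⟩
  have hmR : (2 : ℝ) ≤ (fine (lev L k) M μ : ℕ) := by exact_mod_cast hm'
  have hmpos : (0 : ℝ) < (fine (lev L k) M μ : ℕ) := by linarith
  -- the two profile values: `c(e_μ) = cos(2π/m)`, `c(e_μ − e_μ) = cos 0 = 1`
  have hc1 : cang (fine (lev L k) M μ) ((unitVec (fine (lev L k) M) μ) μ) = Real.cos (2 * π / (fine (lev L k) M μ : ℕ)) := by
    unfold cang; rw [unitVec, Pi.single_eq_same, ZMod.val_one, Nat.cast_one, mul_one]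
  have hc0 : cang (fine (lev L k) M μ) ((unitVec (fine (lev L k) M) μ) μ - 1) = 1 := by
    unfold cang; rw [unitVec, Pi.single_eq_same, sub_self, ZMod.val_zero, Nat.cast_zero, mul_zero, zero_div, Real.cos_zero]
  -- `cos(2π/m) ≠ 1` for `m ≥ 2`
  have hcos : Real.cos (2 * π / (fine (lev L k) M μ : ℕ)) ≠ 1 := by
    intro h
    obtain ⟨j, hj⟩ := (Real.cos_eq_one_iff _).1 h
    -- `j·2π = 2π/m` ⟹ `j·m = 1` in `ℤ` ⟹ `m = ±1`, contradicting `m ≥ 2`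
    have h2π : (0 : ℝ) < 2 * π := by positivity
    have hjm : (j : ℝ) * (fine (lev L k) M μ : ℕ) = 1 := by
      have h3 : (j : ℝ) * (2 * π) * (fine (lev L k) M μ : ℕ) = 2 * π / (fine (lev L k) M μ : ℕ) * (fine (lev L k) M μ : ℕ) :=
        congrArg (· * ((fine (lev L k) M μ : ℕ) : ℝ)) hj
      rw [div_mul_cancel₀ _ hmpos.ne'] at h3
      have h4 : (j : ℝ) * (fine (lev L k) M μ : ℕ) * (2 * π) = 1 * (2 * π) := by linear_combination h3
      exact mul_right_cancel₀ h2π.ne' h4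
    have hjZ : j * ((fine (lev L k) M μ : ℕ) : ℤ) = 1 := by exact_mod_cast hjm
    have hu : IsUnit (((fine (lev L k) M μ : ℕ) : ℤ)) := IsUnit.of_mul_eq_one j (by rw [mul_comm]; exact hjZ)
    rcases Int.isUnit_iff.mp hu with h1 | h1 <;> omega
  -- the size of the step `t = θ(c₁ − 1)`: `0 < |t| < 1`
  set t : ℝ := θ * (Real.cos (2 * π / (fine (lev L k) M μ : ℕ)) - 1) with ht
  have ht0 : t ≠ 0 := mul_ne_zero h0 (sub_ne_zero.mpr hcos)
  have ht1 : |t| < 1 := by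
    rw [ht, abs_mul]
    have hc : |Real.cos (2 * π / (fine (lev L k) M μ : ℕ)) - 1| ≤ 2 := by
      have h1 := Real.abs_cos_le_one (2 * π / (fine (lev L k) M μ : ℕ))
      rw [abs_le] at h1 ⊢; constructor <;> linarith [h1.1, h1.2]
    nlinarith [abs_nonneg θ, abs_nonneg (Real.cos (2 * π / (fine (lev L k) M μ : ℕ)) - 1)]
  -- `D = n•(n•(u₁ − u₀))`, `u₁ − u₀ = u₀·(e^{X₁−X₀} − 1)`, `n•(e^{X₁−X₀} − 1) = wexp t ≠ 0`
  rw [dconnTower_wave_long, hc1, hc0, mul_one, ← smul_uexp_sub_uexp]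
  have hn0 : ((lev L k : ℕ) : ℂ) ≠ 0 := by exact_mod_cast Nat.pos_iff_ne_zero.mp (lt_of_lt_of_le Nat.zero_lt_one (one_le_lev' L k))
  intro h
  rw [smul_eq_zero, smul_eq_zero] at h
  rcases h with h | h | h
  · exact hn0 h
  · exact hn0 h
  · -- `u₁ − u₀ = 0`
    have hcomm : Commute (xlev L θ A k) (xlev L (θ * Real.cos (2 * π / (fine (lev L k) M μ : ℕ))) A k - xlev L θ A k) := by
      rw [xlev, xlev, ← sub_smul]; exact ((Commute.refl A).smul_left _).smul_right _
    have hsplit : uexp L (θ * Real.cos (2 * π / (fine (lev L k) M μ : ℕ))) A k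
        = uexp L θ A k * exp (xlev L (θ * Real.cos (2 * π / (fine (lev L k) M μ : ℕ))) A k - xlev L θ A k) := by
      rw [uexp, uexp, ← exp_add_of_commute hcomm, add_sub_cancel]
    have hZ : xlev L (θ * Real.cos (2 * π / (fine (lev L k) M μ : ℕ))) A k - xlev L θ A k = xlev L t A k := by
      rw [xlev, xlev, xlev, ← sub_smul, ← Complex.ofReal_sub, ← sub_div, ht]; ring_nf
    have hunit : IsUnit (uexp L θ A k) := isUnit_exp _
    rw [hsplit, hZ, ← mul_sub_one, hunit.mul_right_eq_zero] at h
    exact wexp_ne_zero L ht0 ht1 hA0 hA k (by rw [wexp, uexp, h, smul_zero])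

/-! ## §3 Node NE3's hypothesis SHAPE: both class members two-level consistent -/

/-- the derivative member's consistency budget: `βD = |θ|·(Ω³/12 + 3Ω²/2) + 12Ω·θ²`, `Ω = 2π/M_μ`. [folklore] -/
def betaD (M : Fin d → ℕ) (θ : ℝ) (μ : Fin d) : ℝ :=
  |θ| * ((2 * π / (M μ : ℝ)) ^ 3 / 12 + 3 * (2 * π / (M μ : ℝ)) ^ 2 / 2) + 12 * (2 * π / (M μ : ℝ)) * θ ^ 2

omit [NeZero L] hM in
/-- `0 ≤ βD`. [folklore] -/
theorem betaD_nonneg : 0 ≤ betaD M θ μ := by unfold betaD; positivity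

/-- **NODE NE3's HYPOTHESIS SHAPE ON THE LONGITUDINAL WAVE** (`‖A‖ ≤ 1`, `|θ| ≤ ½`): BOTH members of `regClass` — the connection tower AND the
non-trivial lattice-derivative tower — are two-level consistent across the block hierarchy with budget `βw + βD` and rate `L⁻¹`:
`LocalRate (bgReadings L M (regClass L M (liftR L M (waveRg A θ μ μ)))) (betaW + betaD) L⁻¹`, through the owner's faithful adapter
`NE2FromNE3.localRate_of_consistent` BY NAME.  SHAPE on a toy family only; node NE3 for Bałaban's minimisers is OPEN. [folklore] -/
theorem localRate_wave_long {A : Matrix o o ℂ} (hA : ‖A‖ ≤ 1) {θ : ℝ} (hθ : |θ| ≤ 1 / 2) (μ : Fin d) :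
    LocalRate (bgReadings L M (regClass L M (liftR L M (waveRg L M A θ μ μ)))) (betaW M θ μ + betaD M θ μ) ((L : ℝ)⁻¹) := by
  have hθ1 : |θ| ≤ 1 := hθ.trans (by norm_num)
  have hMμ : (0 : ℝ) < M μ := by exact_mod_cast Nat.pos_of_ne_zero (NeZero.ne (M μ))
  have hL1 : (1 : ℝ) ≤ L := by exact_mod_cast Nat.one_le_iff_ne_zero.mpr (NeZero.ne L)
  refine localRate_of_consistent L M fun W hW k ν x' => ?_
  have hn0 : (0 : ℝ) < ((lev L k : ℕ) : ℝ) := lev_pos L k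
  have hn1 : (1 : ℝ) ≤ ((lev L k : ℕ) : ℝ) := one_le_cast_lev L k
  have hmono : ((lev L k : ℕ) : ℝ) ≤ ((lev L (k + 1) : ℕ) : ℝ) := by
    rw [lev_succ', Nat.cast_mul]; exact le_mul_of_one_le_left hn0.le hL1
  have hβW := betaW_nonneg M θ μ
  have hβD := betaD_nonneg M θ μ
  have hpar : (parT (lev L k) L M x').1 μ = par (lev L k) L M x'.1 μ := rfl
  rcases hW with rfl | hW
  · -- the connection member (as in the transverse file, plus `βD ≥ 0`)
    by_cases hν : ν = μ
    · subst hν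
      rw [connTower_wave_self, connTower_wave_self, hpar]
      refine (norm_wexp_sub_wexp_le L hA hθ1 (abs_cang_le _ _) (abs_cang_le _ _) k (k + 1)).trans ?_
      have hcc := abs_cang_sub_cang_par_le L M (lev L k) x'.1 ν
      have hk1 : θ ^ 2 / ((lev L (k + 1) : ℕ) : ℝ) ≤ θ ^ 2 / ((lev L k : ℕ) : ℝ) :=
        div_le_div_of_nonneg_left (sq_nonneg θ) hn0 hmono
      have h2 : |θ| * |cang (fine (lev L (k + 1)) M ν) (x'.1 ν) - cang (fine (lev L k) M ν) (par (lev L k) L M x'.1 ν)|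
          ≤ |θ| * (2 * π / ((lev L k : ℕ) * (M ν : ℝ))) := mul_le_mul_of_nonneg_left hcc (abs_nonneg θ)
      calc θ ^ 2 / ((lev L (k + 1) : ℕ) : ℝ) + θ ^ 2 / ((lev L k : ℕ) : ℝ)
            + |θ| * |cang (fine (lev L (k + 1)) M ν) (x'.1 ν) - cang (fine (lev L k) M ν) (par (lev L k) L M x'.1 ν)|
          ≤ θ ^ 2 / ((lev L k : ℕ) : ℝ) + θ ^ 2 / ((lev L k : ℕ) : ℝ) + |θ| * (2 * π / ((lev L k : ℕ) * (M ν : ℝ))) :=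
            add_le_add (add_le_add hk1 le_rfl) h2
        _ = betaW M θ ν / (lev L k : ℕ) := by unfold betaW; field_simp; ring
        _ ≤ (betaW M θ ν + betaD M θ ν) / (lev L k : ℕ) := by
            refine div_le_div_of_nonneg_right ?_ hn0.le; linarith
    · rw [connTower_wave_ne L M A θ μ μ hν, connTower_wave_ne L M A θ μ μ hν, sub_self, norm_zero]
      positivity
  · -- the lattice-derivative member
    rw [Set.mem_singleton_iff] at hW
    subst hW
    by_cases hν : ν = μ
    · subst hν
      -- main terms at the two levels + the two remainders
      set n : ℝ := ((lev L k : ℕ) : ℝ) with hn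
      set n' : ℝ := ((lev L (k + 1) : ℕ) : ℝ) with hn'
      set Ag : ℝ := ang (fine (lev L k) M ν) ((parT (lev L k) L M x').1 ν) with hAg
      set Ag' : ℝ := ang (fine (lev L (k + 1)) M ν) (x'.1 ν) with hAg'
      set Ω : ℝ := 2 * π / (M ν : ℝ) with hΩ
      have hΩ0 : 0 < Ω := by rw [hΩ]; positivity
      -- the main terms ARE `n(cos Ag − cos(Ag − Ω/n))`
      have hm : ∀ (j : ℕ) (b : ZMod (fine (lev L j) M ν)),
          ((lev L j : ℕ) : ℝ) * (cang (fine (lev L j) M ν) b - cang (fine (lev L j) M ν) (b - 1))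
            = ((lev L j : ℕ) : ℝ) * (Real.cos (ang (fine (lev L j) M ν) b) - Real.cos (ang (fine (lev L j) M ν) b - Ω / ((lev L j : ℕ) : ℝ))) := by
        intro j b
        have hstep : 2 * π / ((fine (lev L j) M ν : ℕ) : ℝ) = Ω / ((lev L j : ℕ) : ℝ) := by
          rw [hΩ]; simp only [fine]; push_cast; rw [div_div]; ring_nf
        rw [cang_sub_one, cang_eq_cos_ang, hstep]
      have hAA : |Ag' - Ag| ≤ Ω / n := by
        rw [hAg', hAg, hpar, hΩ, hn]
        refine (abs_ang_sub_ang_par_le L M (lev L k) x'.1 ν).trans (le_of_eq ?_)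
        field_simp
      have hmain := abs_dmain_sub_le (A := Ag) (A' := Ag') hΩ0 hn1 hmono hAA
      have hρ' := norm_dconn_sub_main_le L M hA hθ ν (k + 1) x'
      have hρ := norm_dconn_sub_main_le L M hA hθ ν k (parT (lev L k) L M x')
      rw [hm (k + 1), ← hAg'] at hρ'
      rw [hm k, ← hAg] at hρ
      -- triangle: `‖D′ − D‖ ≤ ‖D′ − m′A‖ + ‖m′A − mA‖ + ‖D − mA‖`
      have hmid : ‖((θ * (n' * (Real.cos Ag' - Real.cos (Ag' - Ω / n'))) : ℝ) : ℂ) • A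
            - ((θ * (n * (Real.cos Ag - Real.cos (Ag - Ω / n))) : ℝ) : ℂ) • A‖
          ≤ |θ| * ((Ω ^ 3 / 12 + 3 * Ω ^ 2 / 2) / n) := by
        rw [← sub_smul, ← Complex.ofReal_sub, norm_smul, Complex.norm_real, Real.norm_eq_abs, ← mul_sub, abs_mul]
        calc |θ| * |n' * (Real.cos Ag' - Real.cos (Ag' - Ω / n')) - n * (Real.cos Ag - Real.cos (Ag - Ω / n))| * ‖A‖
            ≤ |θ| * ((Ω ^ 3 / 12 + 3 * Ω ^ 2 / 2) / n) * 1 :=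
              mul_le_mul (mul_le_mul_of_nonneg_left hmain (abs_nonneg θ)) hA (norm_nonneg _) (by positivity)
          _ = _ := mul_one _
      have hρ'' : 12 * π * θ ^ 2 / (((lev L (k + 1) : ℕ) : ℝ) * (M ν : ℝ)) ≤ 12 * π * θ ^ 2 / (n * (M ν : ℝ)) := by
        rw [← hn']
        exact div_le_div_of_nonneg_left (by positivity) (by positivity) (mul_le_mul_of_nonneg_right hmono hMμ.le)
      calc ‖dconnTower L M (liftR L M (waveRg L M A θ ν ν)) (k + 1) ν x' - dconnTower L M (liftR L M (waveRg L M A θ ν ν)) k ν (parT (lev L k) L M x')‖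
          = ‖(dconnTower L M (liftR L M (waveRg L M A θ ν ν)) (k + 1) ν x'
                - ((θ * (n' * (Real.cos Ag' - Real.cos (Ag' - Ω / n'))) : ℝ) : ℂ) • A)
              + (((θ * (n' * (Real.cos Ag' - Real.cos (Ag' - Ω / n'))) : ℝ) : ℂ) • A
                - ((θ * (n * (Real.cos Ag - Real.cos (Ag - Ω / n))) : ℝ) : ℂ) • A)
              - (dconnTower L M (liftR L M (waveRg L M A θ ν ν)) k ν (parT (lev L k) L M x')
                - ((θ * (n * (Real.cos Ag - Real.cos (Ag - Ω / n))) : ℝ) : ℂ) • A)‖ := by congr 1; abel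
        _ ≤ 12 * π * θ ^ 2 / (n' * (M ν : ℝ)) + |θ| * ((Ω ^ 3 / 12 + 3 * Ω ^ 2 / 2) / n) + 12 * π * θ ^ 2 / (n * (M ν : ℝ)) := by
            refine (norm_sub_le _ _).trans (add_le_add ((norm_add_le _ _).trans (add_le_add hρ' hmid)) hρ)
        _ ≤ 12 * π * θ ^ 2 / (n * (M ν : ℝ)) + |θ| * ((Ω ^ 3 / 12 + 3 * Ω ^ 2 / 2) / n) + 12 * π * θ ^ 2 / (n * (M ν : ℝ)) := by
            rw [hn']; exact add_le_add (add_le_add hρ'' le_rfl) le_rfl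
        _ = betaD M θ ν / (lev L k : ℕ) := by rw [← hn, hΩ]; unfold betaD; field_simp; ring
        _ ≤ (betaW M θ ν + betaD M θ ν) / (lev L k : ℕ) := by
            refine div_le_div_of_nonneg_right ?_ hn0.le; linarith
    · rw [dconnTower_wave_long_ne L M A θ μ hν, dconnTower_wave_long_ne L M A θ μ hν, sub_self, norm_zero]
      positivity

/-! ## §4 ROOT B's END on the longitudinal wave -/

/-- **ROOT B's END ON THE LONGITUDINAL WAVE, every other binder DISCHARGED** (`L ≥ 2`, `d ≥ 1`, `a′ > 0`, `‖A‖ ≤ 1`, `|θ| + θ² ≤ η⋆`, `βw ≤ η⋆`):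
`NE2BalabanThreshold.balaban_final_rate_of_regular` with `hreg := regularTransporters_wave` (`α = |θ| + θ²`, `β = βw`, p213393), `hNE3 := localRate_wave_long`
(`C = βw + βD` — node NE3's constant is unconstrained by the END), `η := η⋆`.  NOT a statement about Bałaban's minimisers; NE2 NOT proved. [folklore] -/
theorem balaban_final_rate_wave_long (hL : 2 ≤ L) (hd : 1 ≤ d) {a' : ℝ} (ha' : 0 < a') {A : Matrix o o ℂ} (hA : ‖A‖ ≤ 1) (μ : Fin d)
    {θ : ℝ} (hθ : |θ| + θ ^ 2 ≤ etaStar o d a a') (hθβ : betaW M θ μ ≤ etaStar o d a a') :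
    TowerLimitRate (fun k => Qlev L M k ⊗ₖ (1 : Matrix o o ℂ)) ((L : ℝ) ^ d)
      (fun k => (calDalev L M a ha k ⊗ₖ (1 : Matrix o o ℂ)
        + balabanPert L M a (liftR L M (waveRg L M A θ μ μ))
            (gaugeSlot L M (waveRg L M A θ μ μ) (QuT L M o (siteT L M (waveRg L M A θ μ μ))) (Q1 L M o) a') k)⁻¹)
      (Cpert (kappaBs o d a (|θ| + θ ^ 2) (betaW M θ μ)
          (a * (epsR o d (|θ| + θ ^ 2) * (2 + epsR o d (|θ| + θ ^ 2)) * Cst d a)) (kappa4F d a a' (|θ| + θ ^ 2) (betaW M θ μ)))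
        (2 * d * Cst d a) (CJ d a)
        (C2Bs o d L a (|θ| + θ ^ 2) (betaW M θ μ) (betaW M θ μ + betaD M θ μ)
          (a * C2gram (Cst d a) 1 (epsR o d (|θ| + θ ^ 2)) (2 * d * Cst d a) (CJ d a) (Cst d a)
            (CdeltaR o d a (|θ| + θ ^ 2) (theta0 d (|θ| + θ ^ 2) (betaNE3 o (betaW M θ μ + betaD M θ μ)))))
          (C4F o d L a a' (|θ| + θ ^ 2) (betaW M θ μ) (betaW M θ μ + betaD M θ μ))) 0 1) ((L : ℝ)⁻¹) := by
  have hη2 := etaStar_le_half (o := o) (d := d) (a := a) ha'.le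
  have hθh : |θ| ≤ 1 / 2 := by nlinarith [sq_nonneg θ, abs_nonneg θ]
  have hθ1 : |θ| ≤ 1 := hθh.trans (by norm_num)
  have hη := etaStar_pos (o := o) (d := d) a ha.le ha'.le
  exact balaban_final_rate_of_regular L M a ha hL hd (regularTransporters_wave L M hA hθ1 μ μ)
    (add_nonneg (betaW_nonneg M θ μ) (betaD_nonneg M θ μ)) (localRate_wave_long L M hA hθh μ) ha' hθ hθβ le_rfl

/-- **THE UNCONDITIONAL LONGITUDINAL INSTANCE** (`L ≥ 2`, `d ≥ 1`, `a′ > 0`, `‖A‖ ≤ 1`): at `θw = η⋆/(2 + 2π/M_μ)` (p213393's `thetaW_small`) ROOT B's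
END fires for the longitudinal wave with NO smallness hypothesis left.  NE2 NOT proved; nothing about `U_k(V)`. [folklore] -/
theorem balaban_final_rate_wave_long_at (hL : 2 ≤ L) (hd : 1 ≤ d) {a' : ℝ} (ha' : 0 < a') {A : Matrix o o ℂ} (hA : ‖A‖ ≤ 1) (μ : Fin d) :
    let θ : ℝ := thetaW o d a a' M μ
    TowerLimitRate (fun k => Qlev L M k ⊗ₖ (1 : Matrix o o ℂ)) ((L : ℝ) ^ d)
      (fun k => (calDalev L M a ha k ⊗ₖ (1 : Matrix o o ℂ)
        + balabanPert L M a (liftR L M (waveRg L M A θ μ μ))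
            (gaugeSlot L M (waveRg L M A θ μ μ) (QuT L M o (siteT L M (waveRg L M A θ μ μ))) (Q1 L M o) a') k)⁻¹)
      (Cpert (kappaBs o d a (|θ| + θ ^ 2) (betaW M θ μ)
          (a * (epsR o d (|θ| + θ ^ 2) * (2 + epsR o d (|θ| + θ ^ 2)) * Cst d a)) (kappa4F d a a' (|θ| + θ ^ 2) (betaW M θ μ)))
        (2 * d * Cst d a) (CJ d a)
        (C2Bs o d L a (|θ| + θ ^ 2) (betaW M θ μ) (betaW M θ μ + betaD M θ μ)
          (a * C2gram (Cst d a) 1 (epsR o d (|θ| + θ ^ 2)) (2 * d * Cst d a) (CJ d a) (Cst d a)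
            (CdeltaR o d a (|θ| + θ ^ 2) (theta0 d (|θ| + θ ^ 2) (betaNE3 o (betaW M θ μ + betaD M θ μ)))))
          (C4F o d L a a' (|θ| + θ ^ 2) (betaW M θ μ) (betaW M θ μ + betaD M θ μ))) 0 1) ((L : ℝ)⁻¹) := by
  intro θ
  obtain ⟨-, h1, h2⟩ := thetaW_small (o := o) (d := d) M a ha.le ha'.le μ
  exact balaban_final_rate_wave_long L M a ha hL hd ha' hA μ h1 h2

end Summit.QuantumFields.BalabanUV.T4Continuum.NE2BalabanLongWaveWitness

end
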